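import Literature.Analysis.FluidPDE.SerrinEnstrophyGronwallForced
import Literature.Analysis.FluidPDE.TaoForcedBoundedSobolevNormsOfLocalExistence
import Literature.Analysis.FluidPDE.TaoH1LocalExistenceForcedHolds
import HarnessLib

/-!
# No enstrophy blow-up while the velocity stays bounded — classical solutions of the FORCED
# system, with NO hypothesis on the pressure (Lemarié-Rieusset 2016, Thm. 11.2 at `r = ∞`)

Analysis/FluidPDE proof file (cell `pub/ns-blowup`, seat `ns-blowup-ecbridge-7` g4; bears_on the
E–C lane's Literature fact `lemarieRieusset2016_lerayRate_forced` (`NSForcedLerayRate.lean`), whose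
discharge uses it as the continuation step «`u` bounded up to `T` ⇒ enstrophy bounded up to `T` ⇒
smooth extension past `T`» (`lemarieRieusset2016_H1_continuation_forced_holds`); theorems only, no
definitions, no named facts). WHAT THIS IS NOT: not a statement about Navier–Stokes blow-up —
an a-priori bound for GIVEN classical solutions of the forced system.

**The statement** (`exists_enstrophy_le_of_norm_le_forced`). Let `ν > 0`, `0 < T`, and let `(u, p)`
be a classical solution of the forced Navier–Stokes system on `ℝ³ × [0, T)` with a Clay-class force
`f` (`C^∞` on `[0,∞) × ℝ³` with Fefferman's decay (5)), such that `u` has bounded `L²` Sobolev norms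
of every order on each closed sub-slab `[0, T']`, `T' < T` (Tao's class, slab by slab — the bounds
may degenerate as `T' → T`), and such that the VELOCITY IS BOUNDED UP TO `T`: `|u(t, x)| ≤ K` on
`[0, T) × ℝ³`. Then the enstrophy is bounded up to `T`: `∫ |∇u(t)|² ≤ B` for all `t ∈ [0, T)`,
indeed `∫|∇u(t)|² ≤ e^{κ K² t} (∫|∇u(0)|² + ν⁻¹ t sup_s ‖f(s)‖²₂)` with the constant `κ = κ(ν)` of the
tree's forced Serrin slab inequality at `r = ∞` (`serrin_enstrophy_le_mul_exp_forced`,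
Lemarié-Rieusset 2016, Thm. 11.2, (11.11) with `q = ∞`, `p = 2`: `θ = 1`).

**Why a separate file / what is new.** The tree's slab inequality
`serrin_enstrophy_le_mul_exp_forced` (and its corollary `enstrophy_le_of_serrin_forced_uniform`)
asks for the pressure to have bounded `L²` Sobolev norms of every order on the slab — in particular
`p(t) ∈ L²` — which a classical solution `(u, p)` only has in Tao's normalised gauge; a blow-up
construction (or the named fact `lemarieRieusset2016_lerayRate_forced`) hands over an ARBITRARY
smooth pressure. Here the pressure hypothesis is REMOVED by a re-gauging device that never names the
normalised pressure: on each short piece `[τ, τ + h] ⊆ [0, T']` the forced smooth local existence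
theorem (`tao2011_smooth_local_existence_forced_holds`, Tao 2013 Thm. 5.4 (ii)+(iv) WITH force,
lifespan `h` uniform on `[0, T']` by the slab `H¹` bound) produces from the datum `u(τ)` a Tao-class
solution `(v, q)` WITH pressure bounds of every order, which coincides with the shifted flow
`u(· + τ)` (uniqueness of classical solutions with bounded Sobolev norms,
`IsClassicalNSSolutionOn.velocity_eq_of_hasBoundedSobolevNormsOn`); the slab inequality is applied
to `(v, q)` on the piece, and the piece bounds
`E(τ + σ) ≤ e^{κ K² σ} (E(τ) + ν⁻¹ F₀ σ)` chain along `τ = 0, h, 2h, …` to the closed form above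
(`e^{a} (e^{b} X + Y) ≤ e^{a+b} (X + Y)` for `b ≥ 0`), which does not remember `h` or `T'`.

## Mathlib / tree search

Tree: `serrin_enstrophy_le_mul_exp_forced` (`SerrinEnstrophyGronwallForced`),
`tao2011_smooth_local_existence_forced_holds` (`TaoH1LocalExistenceForcedHolds`),
`TaoForcedJ1.shift_Icc` / `TaoForcedJ1.hasBoundedSobolevNormsOn_shift`
(`TaoForcedBoundedSobolevNormsOfLocalExistence`),
`IsClassicalNSSolutionOn.velocity_eq_of_hasBoundedSobolevNormsOn` (`ClassicalSobolevUniqueness`),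
`HasRapidSpaceTimeDecay.exists_lintegral_iteratedFDeriv_slice_sq_le_all`
(`NSEnstrophyPersistenceForced`), `IsSmoothOnHalfSpace.isSmoothSpaceTimeOn_Icc_timeShift` /
`HasRapidSpaceTimeDecay.hasUniformRapidDecayOn_Icc_timeShift` (`ClayForceTimeShift`),
`ofReal_frobeniusNormSq_le_three_mul_enorm_sq` (`EnstrophyGronwall`).
`lean search 'enstrophy_le_of_norm_le|enstrophy.*supnorm|enstrophy.*bounded_velocity'`: nothing for
the forced classical class without pressure hypotheses (`enstrophy_le_of_serrin_forced_uniform` needs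
`hp`; `exists_eH1NormSq_le_of_serrin_forced` needs a Leray–Hopf solution up to and including `T`).

## References

* P. G. Lemarié-Rieusset, *The Navier–Stokes Problem in the 21st Century*, CRC Press (2016),
  §11.3, Thm. 11.2 with (11.9)–(11.11) (PDF pp. 338–339 of doi:10.1201/b19556). [LemarieRieusset2016]
* T. Tao, *Localisation and compactness properties of the Navier–Stokes global regularity problem*,
  Anal. PDE 6 (2013) 25–107 = arXiv:1108.1165, Thm. 5.4 (ii)+(iv) (arXiv Thm. 31). [Tao2011]
* J. Serrin, *On the interior regularity of weak solutions of the Navier–Stokes equations*,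
  Arch. Rational Mech. Anal. 9 (1962) 187–195. [Serrin1962]
-/

noncomputable section

open MeasureTheory Set Function Filter Topology
open scoped ENNReal NNReal ContDiff

namespace Literature.Analysis.FluidPDE

namespace ForcedEnstrophyOfSupNorm

variable {ν T : ℝ} {f u : ℝ → EuclideanSpace ℝ (Fin 3) → EuclideanSpace ℝ (Fin 3)}
  {p : ℝ → EuclideanSpace ℝ (Fin 3) → ℝ}

/-! ### Plumbing -/

/-- `‖D⁰g‖ = ‖g‖` under the integral sign. [folklore] -/
private theorem lintegral_iteratedFDeriv_zero_eq {F : Type*} [NormedAddCommGroup F] [NormedSpace ℝ F]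
    (g : EuclideanSpace ℝ (Fin 3) → F) :
    ∫⁻ x, ‖iteratedFDeriv ℝ 0 g x‖ₑ ^ 2 = ∫⁻ x, ‖g x‖ₑ ^ 2 :=
  lintegral_congr fun x => by rw [← ofReal_norm, norm_iteratedFDeriv_zero, ofReal_norm]

/-- The `H¹` packaging used by the forced local existence theorem: `L²` bounds of orders `0` and `1`
give `∫|g|² + ∫|∇g|²_F ≤ (√(G₀ + 3G₁))²` (`|∇g|²_F ≤ 3‖Dg‖²` in dimension three). [folklore] -/
private theorem H1_pack {g : EuclideanSpace ℝ (Fin 3) → EuclideanSpace ℝ (Fin 3)} {G₀ G₁ : ℝ≥0}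
    (h0 : ∫⁻ x, ‖iteratedFDeriv ℝ 0 g x‖ₑ ^ 2 ≤ G₀) (h1 : ∫⁻ x, ‖iteratedFDeriv ℝ 1 g x‖ₑ ^ 2 ≤ G₁) :
    (∫⁻ x, ‖g x‖ₑ ^ 2) + (∫⁻ x, ENNReal.ofReal (frobeniusNormSq (fderiv ℝ g x))) ≤
      ENNReal.ofReal ((Real.sqrt (G₀ + 3 * G₁)) ^ 2) := by
  rw [Real.sq_sqrt (by positivity), ENNReal.ofReal_add (by positivity) (by positivity),
    ENNReal.ofReal_coe_nnreal, ENNReal.ofReal_mul (by norm_num), ENNReal.ofReal_coe_nnreal,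
    show ENNReal.ofReal (3 : ℝ) = 3 by norm_num]
  refine add_le_add (by rwa [← lintegral_iteratedFDeriv_zero_eq]) ?_
  calc ∫⁻ x, ENNReal.ofReal (frobeniusNormSq (fderiv ℝ g x))
      ≤ ∫⁻ x, 3 * ‖iteratedFDeriv ℝ 1 g x‖ₑ ^ 2 := lintegral_mono fun x => by
        rw [← ofReal_norm, norm_iteratedFDeriv_one, ofReal_norm]
        exact ofReal_frobeniusNormSq_le_three_mul_enorm_sq _
    _ = 3 * ∫⁻ x, ‖iteratedFDeriv ℝ 1 g x‖ₑ ^ 2 := lintegral_const_mul' _ _ (by norm_num)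
    _ ≤ 3 * G₁ := by gcongr

/-- **One uniform step.** For `A, B ≥ 0`, `c, ν, T > 0` there are `h > 0` and `N ≥ 1` with
`T = N h` and Tao's smallness `(A + Bh)⁴ h ≤ c ν³`. [cite: Tao2011, Thm. 5.4 (ii) (arXiv Thm. 31)] -/
private theorem exists_uniform_step {A B c : ℝ} (hA : 0 ≤ A) (hB : 0 ≤ B) (hc : 0 < c)
    (hν : 0 < ν) (hT : 0 < T) :
    ∃ h : ℝ, 0 < h ∧ ∃ N : ℕ, 0 < N ∧ T = N * h ∧ (A + B * h) ^ 4 * h ≤ c * ν ^ 3 := by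
  set D : ℝ := (A + B + 1) ^ 4 with hD
  have hDpos : 0 < D := by positivity
  set h₀ : ℝ := min 1 (c * ν ^ 3 / D) with hh₀
  have hh₀pos : 0 < h₀ := lt_min one_pos (div_pos (by positivity) hDpos)
  have hh₀1 : h₀ ≤ 1 := min_le_left _ _
  have hh₀D : D * h₀ ≤ c * ν ^ 3 := by
    have : h₀ ≤ c * ν ^ 3 / D := min_le_right _ _
    rwa [le_div_iff₀ hDpos, mul_comm] at this
  set N : ℕ := ⌈T / h₀⌉₊ with hN
  have hTN : T / h₀ ≤ N := Nat.le_ceil _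
  have hNpos' : (0 : ℝ) < N := lt_of_lt_of_le (div_pos hT hh₀pos) hTN
  have hNpos : 0 < N := by exact_mod_cast hNpos'
  set h : ℝ := T / N with hh
  have hhpos : 0 < h := div_pos hT hNpos'
  have hhh₀ : h ≤ h₀ := by
    rw [hh, div_le_iff₀ hNpos']
    have := mul_le_mul_of_nonneg_left hTN hh₀pos.le
    rw [mul_div_cancel₀ _ hh₀pos.ne'] at this
    linarith [mul_comm h₀ (N : ℝ)]
  refine ⟨h, hhpos, N, hNpos, by rw [hh, mul_div_cancel₀ _ hNpos'.ne'], ?_⟩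
  have h1 : A + B * h ≤ A + B + 1 := by nlinarith [hhh₀.trans hh₀1]
  calc (A + B * h) ^ 4 * h ≤ D * h := by
        rw [hD]
        exact mul_le_mul_of_nonneg_right (pow_le_pow_left₀ (by positivity) h1 4) hhpos.le
    _ ≤ D * h₀ := by gcongr
    _ ≤ c * ν ^ 3 := hh₀D

/-- The chaining inequality `e₂ (e₁ X + Y) ≤ (e₂ e₁)(X + Y)` for `e₁ ≥ 1` (in `ℝ≥0∞`, with
`X = a`, `Y = c`, and an extra summand `b` carried inside: `e₂ (e₁ (a + b) + c) ≤ (e₂ e₁) (a + (b + c))`).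
[folklore] -/
private theorem chain_le {e₁ e₂ a b c : ℝ≥0∞} (he₁ : 1 ≤ e₁) :
    e₂ * (e₁ * (a + b) + c) ≤ e₂ * e₁ * (a + (b + c)) := by
  have hc : c ≤ e₁ * c := by
    calc c = 1 * c := (one_mul c).symm
      _ ≤ e₁ * c := by gcongr
  calc e₂ * (e₁ * (a + b) + c) ≤ e₂ * (e₁ * (a + b) + e₁ * c) := by gcongr
    _ = e₂ * e₁ * (a + (b + c)) := by ring

/-- A constant integrated over `(0, σ)`: `∫_{(0,σ)} C = C σ`. [folklore] -/
private theorem setLIntegral_Ioo_const (σ : ℝ) (C : ℝ≥0∞) :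
    ∫⁻ _ in Ioo (0 : ℝ) σ, C = C * ENNReal.ofReal σ := by
  rw [setLIntegral_const, Real.volume_Ioo, sub_zero]

/-! ### One piece: the slab inequality at `r = ∞` for the re-gauged flow -/

/-- **The piece bound.** For `ν > 0` there is a rate `κ = κ(ν) ≥ 0` (namely `2 C(1) (ν/2)^{-1}`,
`C(θ)` the constant of `serrin_enstrophy_le_mul_exp_forced`, at `θ = 1`, i.e. `r = ∞`) such that:
if `(u, p)` is classical on the closed slab `[0, S] × ℝ³` with bounded Sobolev norms of every order,
`f` is Clay-class with `sup_{t ≥ 0} ‖f(t)‖²₂ ≤ F₀`, `sup_{t ≥ 0} ‖Df(t)‖²₂ ≤ F₁`, `|u| ≤ K` on the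
slab (`K ≥ 0`), and `[τ, τ + h] ⊆ [0, S]` is a piece on which the forced local existence theorem
(hypothesis `hloc`, the shape of `tao2011_smooth_local_existence_forced`) applies from the datum
`u(τ)` (Tao's smallness `(A + B h)⁴ h ≤ c ν³` with the slab `H¹` bounds `A` of `u(·)` and `B` of
`f(·)`), then for `σ ∈ (0, h]`
`∫|∇u(τ + σ)|² ≤ e^{κ K² σ} (∫|∇u(τ)|² + ν⁻¹ F₀ σ)`.
The pressure `p` is never used: the slab inequality (Lemarié-Rieusset 2016, Thm. 11.2, (11.11) at
`q = ∞`) is applied to the local solution `(v, q)` from `u(τ)` (Tao 2013, Thm. 5.4 (ii)+(iv) WITH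
force), which carries pressure bounds of every order and coincides with `u(· + τ)` on the piece
(uniqueness with bounded Sobolev norms). [cite: LemarieRieusset2016, Thm. 11.2 (11.11)]
[cite: Tao2011, Thm. 5.4 (ii)+(iv) (arXiv Thm. 31)] -/
theorem exists_piece_rate (hν : 0 < ν) {c : ℝ}
    (hloc : ∀ ⦃ν T : ℝ⦄, 0 < ν → 0 < T →
      ∀ ⦃u₀ : EuclideanSpace ℝ (Fin 3) → EuclideanSpace ℝ (Fin 3)⦄,
        ContDiff ℝ ∞ u₀ → VectorCalculus.IsDivFree u₀ →
        (∀ n : ℕ, ∫⁻ x, ‖iteratedFDeriv ℝ n u₀ x‖ₑ ^ 2 < ⊤) →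
      ∀ ⦃f : ℝ → EuclideanSpace ℝ (Fin 3) → EuclideanSpace ℝ (Fin 3)⦄,
        IsSmoothSpaceTimeOn (Icc 0 T) f → HasUniformRapidDecayOn (Icc 0 T) f →
        ∀ ⦃A B : ℝ⦄, 0 ≤ A → 0 ≤ B →
          (∫⁻ x, ‖u₀ x‖ₑ ^ 2) + (∫⁻ x, ENNReal.ofReal (frobeniusNormSq (fderiv ℝ u₀ x))) ≤
              ENNReal.ofReal (A ^ 2) →
          (∀ t ∈ Icc 0 T,
            (∫⁻ x, ‖f t x‖ₑ ^ 2) + (∫⁻ x, ENNReal.ofReal (frobeniusNormSq (fderiv ℝ (f t) x))) ≤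
              ENNReal.ofReal (B ^ 2)) →
          (A + B * T) ^ 4 * T ≤ c * ν ^ 3 →
          ∃ (u : ℝ → EuclideanSpace ℝ (Fin 3) → EuclideanSpace ℝ (Fin 3))
            (p : ℝ → EuclideanSpace ℝ (Fin 3) → ℝ),
            IsClassicalNSSolutionOn (Icc 0 T) ν f u p ∧ u 0 = u₀ ∧
            HasBoundedSobolevNormsOn (Icc 0 T) u ∧
            HasBoundedSobolevNormsOn (Icc 0 T) (timeDerivWithin (Icc 0 T) u) ∧
            (∀ n : ℕ, ∃ C : ℝ≥0, ∀ t ∈ Icc 0 T, ∫⁻ x, ‖iteratedFDeriv ℝ n (p t) x‖ₑ ^ 2 ≤ C) ∧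
            ContinuousInLpOn (Icc 0 T) 2 u) :
    ∃ κ : ℝ, 0 ≤ κ ∧ ∀ ⦃A B S : ℝ⦄
      ⦃f u : ℝ → EuclideanSpace ℝ (Fin 3) → EuclideanSpace ℝ (Fin 3)⦄
      ⦃p : ℝ → EuclideanSpace ℝ (Fin 3) → ℝ⦄,
      IsClassicalNSSolutionOn (Icc 0 S) ν f u p → HasBoundedSobolevNormsOn (Icc 0 S) u →
      IsSmoothOnHalfSpace f → HasRapidSpaceTimeDecay f →
      ∀ ⦃K : ℝ⦄, 0 ≤ K → (∀ t ∈ Icc 0 S, ∀ x, ‖u t x‖ ≤ K) →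
      ∀ ⦃F₀ F₁ : ℝ≥0⦄, (∀ t, 0 ≤ t → ∫⁻ x, ‖iteratedFDeriv ℝ 0 (f t) x‖ₑ ^ 2 ≤ F₀) →
        (∀ t, 0 ≤ t → ∫⁻ x, ‖iteratedFDeriv ℝ 1 (f t) x‖ₑ ^ 2 ≤ F₁) →
      0 ≤ A → 0 ≤ B →
      (∀ τ ∈ Icc 0 S, (∫⁻ x, ‖u τ x‖ₑ ^ 2) +
        (∫⁻ x, ENNReal.ofReal (frobeniusNormSq (fderiv ℝ (u τ) x))) ≤ ENNReal.ofReal (A ^ 2)) →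
      (∀ t, 0 ≤ t → (∫⁻ x, ‖f t x‖ₑ ^ 2) +
        (∫⁻ x, ENNReal.ofReal (frobeniusNormSq (fderiv ℝ (f t) x))) ≤ ENNReal.ofReal (B ^ 2)) →
      ∀ ⦃h : ℝ⦄, 0 < h → (A + B * h) ^ 4 * h ≤ c * ν ^ 3 →
      ∀ ⦃τ : ℝ⦄, 0 ≤ τ → τ + h ≤ S → ∀ ⦃σ : ℝ⦄, σ ∈ Ioc 0 h →
      ∫⁻ x, ENNReal.ofReal (frobeniusNormSq (fderiv ℝ (u (τ + σ)) x)) ≤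
        ENNReal.ofReal (Real.exp (κ * (K ^ 2 * σ))) *
          ((∫⁻ x, ENNReal.ofReal (frobeniusNormSq (fderiv ℝ (u τ) x))) +
            (ENNReal.ofReal ν)⁻¹ * ((F₀ : ℝ≥0∞) * ENNReal.ofReal σ)) := by
  -- the exponent bookkeeping at `r = ⊤`, `θ = 1`
  set θ : ℝ := 1 - (3 / (⊤ : ℝ≥0∞)).toReal with hθdef
  have hθ1 : θ = 1 := by rw [hθdef, ENNReal.div_top, ENNReal.toReal_zero, sub_zero]
  set Cθ : ℝ := θ * (2 * (1 - θ)) ^ ((1 - θ) / θ) * 2 ^ (-(1 / θ)) *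
      (SNormLESNormFDerivOfEqConst (EuclideanSpace ℝ (Fin 3))
        (volume : Measure (EuclideanSpace ℝ (Fin 3))) 2 : ℝ) ^ (2 * (1 - θ) / θ) with hCθ
  have hCθ0 : 0 ≤ Cθ := by
    have : 0 ≤ 1 - θ := by rw [hθ1]; norm_num
    have hθ0 : 0 ≤ θ := by rw [hθ1]; norm_num
    positivity
  have hκ0 : 0 ≤ 2 * Cθ * (ν / 2) ^ (1 - 2 / θ) := by positivity
  refine ⟨2 * Cθ * (ν / 2) ^ (1 - 2 / θ), hκ0, ?_⟩
  intro A B S f u p hsol hub hfs hfd K hK0 hK F₀ F₁ hF₀ hF₁ hA hB hAu hBf h hh hsmall τ hτ hτh σ hσ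
  have hτS : τ ∈ Icc 0 S := ⟨hτ, by linarith [hσ.1]⟩
  -- F2 on the piece, from the datum `u τ` and the shifted force
  obtain ⟨v, q, hsol', hv0, hvb, hvt, hq, -⟩ := hloc hν hh (hsol.contDiff_velocity hτS)
    (hsol.divFree τ hτS)
    (fun n => by obtain ⟨C, hC⟩ := hub n; exact (hC τ hτS).trans_lt ENNReal.coe_lt_top)
    (hfs.isSmoothSpaceTimeOn_Icc_timeShift hτ h) (hfd.hasUniformRapidDecayOn_Icc_timeShift hfs hτ hh)
    hA hB (hAu τ hτS) (fun s hs => hBf (s + τ) (by linarith [hs.1])) hsmall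
  -- the shifted flow coincides with the local solution
  have hshift := TaoForcedJ1.shift_Icc hsol hτ hh hτh
  have heqv : ∀ s ∈ Icc 0 h, u (s + τ) = v s := by
    have h0 : (fun s => u (s + τ)) 0 = v 0 := by simp [hv0]
    exact hshift.velocity_eq_of_hasBoundedSobolevNormsOn hsol' hν.le hh
      (TaoForcedJ1.hasBoundedSobolevNormsOn_shift hub hτ hτh) hvb h0
  -- force bookkeeping on the piece
  have hfτ : ∀ n : ℕ, n ≤ 1 → ∃ C : ℝ≥0, ∀ t ∈ Icc 0 h,
      ∫⁻ x, ‖iteratedFDeriv ℝ n ((fun s => f (s + τ)) t) x‖ₑ ^ 2 ≤ C := by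
    intro n hn
    rcases Nat.le_one_iff_eq_zero_or_eq_one.1 hn with h0 | h1
    · subst h0; exact ⟨F₀, fun t ht => hF₀ (t + τ) (by linarith [ht.1])⟩
    · subst h1; exact ⟨F₁, fun t ht => hF₁ (t + τ) (by linarith [ht.1])⟩
  have hFio : ∀ t ∈ Ioo 0 h, ∫⁻ x, ‖(fun s => f (s + τ)) t x‖ₑ ^ 2 ≤ (F₀ : ℝ≥0∞) := by
    intro t ht
    have := hF₀ (t + τ) (by linarith [ht.1])
    rwa [lintegral_iteratedFDeriv_zero_eq] at this
  -- the Serrin integral of `v` on `(0, σ)` at `r = ⊤`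
  have hσh : Ioo 0 σ ⊆ Icc 0 h := fun t ht => ⟨ht.1.le, ht.2.le.trans hσ.2⟩
  have hvK : ∀ t ∈ Icc 0 h, eLpNorm (v t) ⊤ volume ≤ ENNReal.ofReal K := by
    intro t ht
    rw [← heqv t ht, eLpNorm_exponent_top]
    exact eLpNormEssSup_le_of_ae_bound (Eventually.of_forall fun x =>
      hK (t + τ) ⟨by linarith [ht.1], by linarith [ht.2]⟩ x)
  have hAle : ∫⁻ t in Ioo 0 σ, ENNReal.ofReal ((eLpNorm (v t) ⊤ volume).toReal ^ (2 / θ)) ≤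
      ENNReal.ofReal (K ^ 2) * ENNReal.ofReal σ := by
    rw [← setLIntegral_Ioo_const σ]
    refine setLIntegral_mono' measurableSet_Ioo fun t ht => ENNReal.ofReal_le_ofReal ?_
    rw [hθ1, div_one, Real.rpow_two]
    have h1 : (eLpNorm (v t) ⊤ volume).toReal ≤ K :=
      ENNReal.toReal_le_of_le_ofReal hK0 (hvK t (hσh ht))
    exact pow_le_pow_left₀ ENNReal.toReal_nonneg h1 2
  have hAtop : ∫⁻ t in Ioo 0 σ, ENNReal.ofReal ((eLpNorm (v t) ⊤ volume).toReal ^ (2 / θ)) ≠ ⊤ :=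
    ne_top_of_le_ne_top (ENNReal.mul_ne_top ENNReal.ofReal_ne_top ENNReal.ofReal_ne_top) hAle
  have hFs : ∫⁻ _ in Ioo 0 σ, (F₀ : ℝ≥0∞) ≠ ⊤ := by
    rw [setLIntegral_Ioo_const σ]
    exact ENNReal.mul_ne_top ENNReal.coe_ne_top ENNReal.ofReal_ne_top
  -- the slab inequality for `(v, q)` on `[0, h]` at time `σ`
  have hS := serrin_enstrophy_le_mul_exp_forced hν hh hsol' hvb hvt hq hfτ (fun _ => (F₀ : ℝ≥0∞))
    measurable_const hFio (r := ⊤) (by simp) hθdef hσ hAtop hFs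
  -- translate back to `u`
  have hvσ : v σ = u (τ + σ) := by rw [← heqv σ ⟨hσ.1.le, hσ.2⟩, add_comm]
  have hv0' : v 0 = u τ := hv0
  rw [hvσ, hv0', setLIntegral_Ioo_const σ] at hS
  refine hS.trans ?_
  gcongr
  · exact (ENNReal.toReal_mono (ENNReal.mul_ne_top ENNReal.ofReal_ne_top ENNReal.ofReal_ne_top)
      hAle).trans (by rw [← ENNReal.ofReal_mul (sq_nonneg _),
        ENNReal.toReal_ofReal (mul_nonneg (sq_nonneg _) hσ.1.le)])

/-! ### The chained bound up to the final time -/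

/-- **No enstrophy blow-up while the velocity stays bounded (forced, classical, pressure-free).**
Let `ν > 0`, `0 < T`, `(u, p)` a classical solution of the forced Navier–Stokes system on
`ℝ³ × [0, T)` with Clay-class force `f`, with `u` in Tao's class on every closed sub-slab `[0, T']`,
`T' < T`, and with BOUNDED VELOCITY up to `T`: `|u(t, x)| ≤ K` on `[0, T) × ℝ³`. Then the enstrophy
is bounded up to `T`: there is `B` with `∫ |∇u(t)|² ≤ B` for every `t ∈ [0, T)` — Lemarié-Rieusset
2016, Thm. 11.2, second clause («if `T_MAX < +∞` then `∫₀^{T_MAX} ‖u‖_q^p dt = +∞`») at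
`(p, q) = (2, ∞)`, in a-priori form for classical solutions, the pressure hypothesis of the tree's
`enstrophy_le_of_serrin_forced_uniform` being removed by the re-gauging through the forced local
existence theorem (`exists_piece_rate`) chained along a uniform partition of each `[0, t]`, `t < T`:
`∫|∇u(t)|² ≤ e^{κ K² t} (∫|∇u(0)|² + ν⁻¹ F₀ t)` with `F₀ = sup_s ‖f(s)‖²₂`, a bound that does not
remember the partition. [cite: LemarieRieusset2016, Thm. 11.2 (11.11)]
[cite: Tao2011, Thm. 5.4 (ii)+(iv) (arXiv Thm. 31)] -/
theorem exists_enstrophy_le_of_norm_le_forced (hν : 0 < ν) (hT : 0 < T)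
    (hsol : IsClassicalNSSolutionOn (Ico 0 T) ν f u p)
    (hTao : ∀ T' ∈ Ioo 0 T, HasBoundedSobolevNormsOn (Icc 0 T') u)
    (hfs : IsSmoothOnHalfSpace f) (hfd : HasRapidSpaceTimeDecay f)
    {K : ℝ} (hK : ∀ t ∈ Ico 0 T, ∀ x, ‖u t x‖ ≤ K) :
    ∃ B : ℝ≥0, ∀ t ∈ Ico 0 T,
      ∫⁻ x, ENNReal.ofReal (frobeniusNormSq (fderiv ℝ (u t) x)) ≤ B := by
  obtain ⟨c, hc, hloc⟩ := tao2011_smooth_local_existence_forced_holds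
  obtain ⟨κ, hκ0, hpiece⟩ := exists_piece_rate hν hloc
  -- wlog `K ≥ 0`
  set K' : ℝ := max K 0 with hK'def
  have hK'0 : 0 ≤ K' := le_max_right _ _
  have hK' : ∀ t ∈ Ico 0 T, ∀ x, ‖u t x‖ ≤ K' :=
    fun t ht x => (hK t ht x).trans (le_max_left _ _)
  -- force constants
  obtain ⟨F₀, hF₀⟩ := hfd.exists_lintegral_iteratedFDeriv_slice_sq_le_all (μ := volume) hfs 0
  obtain ⟨F₁, hF₁⟩ := hfd.exists_lintegral_iteratedFDeriv_slice_sq_le_all (μ := volume) hfs 1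
  set Bf : ℝ := Real.sqrt (F₀ + 3 * F₁) with hBfdef
  have hBf0 : 0 ≤ Bf := Real.sqrt_nonneg _
  have hBf : ∀ t, 0 ≤ t → (∫⁻ x, ‖f t x‖ₑ ^ 2) +
      (∫⁻ x, ENNReal.ofReal (frobeniusNormSq (fderiv ℝ (f t) x))) ≤ ENNReal.ofReal (Bf ^ 2) :=
    fun t ht => H1_pack (hF₀ t ht) (hF₁ t ht)
  -- the enstrophy and its majorant
  set E : ℝ → ℝ≥0∞ := fun t => ∫⁻ x, ENNReal.ofReal (frobeniusNormSq (fderiv ℝ (u t) x)) with hEdef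
  set Φ : ℝ → ℝ≥0∞ := fun s => ENNReal.ofReal (Real.exp (κ * (K' ^ 2 * s))) *
    (E 0 + (ENNReal.ofReal ν)⁻¹ * ((F₀ : ℝ≥0∞) * ENNReal.ofReal s)) with hΦdef
  have hΦ0 : E 0 ≤ Φ 0 := by
    simp only [hΦdef, mul_zero, Real.exp_zero, ENNReal.ofReal_one, one_mul, ENNReal.ofReal_zero,
      add_zero]
    exact le_rfl
  -- ### the bound `E t ≤ Φ t` on `[0, T)`
  have hmain : ∀ t ∈ Ico 0 T, E t ≤ Φ t := by
    intro t ht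
    rcases ht.1.eq_or_lt with h0 | ht0
    · rw [← h0]; exact hΦ0
    have htI : t ∈ Ioo 0 T := ⟨ht0, ht.2⟩
    have hsolt : IsClassicalNSSolutionOn (Icc 0 t) ν f u p :=
      hsol.mono (Icc_subset_Ico_right ht.2) (uniqueDiffOn_Icc ht0)
    have hub : HasBoundedSobolevNormsOn (Icc 0 t) u := hTao t htI
    obtain ⟨C₀, hC₀⟩ := hub 0
    obtain ⟨C₁, hC₁⟩ := hub 1
    set A : ℝ := Real.sqrt (C₀ + 3 * C₁) with hAdef
    have hA : 0 ≤ A := Real.sqrt_nonneg _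
    have hAu : ∀ τ ∈ Icc 0 t, (∫⁻ x, ‖u τ x‖ₑ ^ 2) +
        (∫⁻ x, ENNReal.ofReal (frobeniusNormSq (fderiv ℝ (u τ) x))) ≤ ENNReal.ofReal (A ^ 2) :=
      fun τ hτ => H1_pack (hC₀ τ hτ) (hC₁ τ hτ)
    have hKt : ∀ s ∈ Icc 0 t, ∀ x, ‖u s x‖ ≤ K' :=
      fun s hs x => hK' s ⟨hs.1, hs.2.trans_lt ht.2⟩ x
    obtain ⟨h, hh, N, -, htN, hsmall⟩ := exists_uniform_step hA hBf0 hc hν ht0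
    -- induction along the pieces `[kh, (k+1)h]`
    have hind : ∀ k : ℕ, (k : ℝ) * h ≤ t → ∀ s ∈ Icc 0 ((k : ℝ) * h), E s ≤ Φ s := by
      intro k
      induction k with
      | zero =>
        intro _ s hs
        have hs0 : s = 0 := le_antisymm (by simpa using hs.2) hs.1
        rw [hs0]; exact hΦ0
      | succ k ih =>
        intro hk s hs
        push_cast at hk hs
        have hτ0 : 0 ≤ (k : ℝ) * h := by positivity
        have hkh : (k : ℝ) * h ≤ t := by nlinarith
        by_cases hsk : s ≤ k * h
        · exact ih hkh s ⟨hs.1, hsk⟩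
        push Not at hsk
        have hτh : (k : ℝ) * h + h ≤ t := by linarith
        have hσ : s - k * h ∈ Ioc 0 h := ⟨by linarith, by linarith [hs.2]⟩
        have hP := hpiece hsolt hub hfs hfd hK'0 hKt hF₀ hF₁ hA hBf0 hAu hBf hh hsmall hτ0 hτh hσ
        rw [add_sub_cancel] at hP
        have hIH : E (k * h) ≤ Φ (k * h) := ih hkh (k * h) ⟨hτ0, le_rfl⟩
        calc E s ≤ ENNReal.ofReal (Real.exp (κ * (K' ^ 2 * (s - k * h)))) *
              (E (k * h) + (ENNReal.ofReal ν)⁻¹ * ((F₀ : ℝ≥0∞) * ENNReal.ofReal (s - k * h))) := hP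
          _ ≤ ENNReal.ofReal (Real.exp (κ * (K' ^ 2 * (s - k * h)))) *
              (Φ (k * h) + (ENNReal.ofReal ν)⁻¹ * ((F₀ : ℝ≥0∞) * ENNReal.ofReal (s - k * h))) := by
            gcongr
          _ ≤ Φ s := by
            simp only [hΦdef]
            refine (chain_le (ENNReal.one_le_ofReal.2 (Real.one_le_exp (by positivity)))).trans
              (le_of_eq ?_)
            have hF : (ENNReal.ofReal ν)⁻¹ * ((F₀ : ℝ≥0∞) * ENNReal.ofReal (k * h)) +
                (ENNReal.ofReal ν)⁻¹ * ((F₀ : ℝ≥0∞) * ENNReal.ofReal (s - k * h)) =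
                (ENNReal.ofReal ν)⁻¹ * ((F₀ : ℝ≥0∞) * ENNReal.ofReal s) := by
              rw [← mul_add, ← mul_add, ← ENNReal.ofReal_add hτ0 hσ.1.le, add_sub_cancel]
            rw [← ENNReal.ofReal_mul (Real.exp_nonneg _), ← Real.exp_add, hF,
              show κ * (K' ^ 2 * (s - k * h)) + κ * (K' ^ 2 * (k * h)) = κ * (K' ^ 2 * s) by ring]
    -- `t = N h`
    exact hind N (by rw [htN]) t ⟨ht.1, by rw [← htN]⟩
  -- ### the uniform constant
  have hE0 : E 0 < ⊤ := by
    have hT2 : T / 2 ∈ Ioo 0 T := ⟨by linarith, by linarith⟩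
    obtain ⟨C₁, hC₁⟩ := hTao (T / 2) hT2 1
    have h0 : (0 : ℝ) ∈ Icc 0 (T / 2) := ⟨le_rfl, by linarith⟩
    calc E 0 ≤ ∫⁻ x, 3 * ‖iteratedFDeriv ℝ 1 (u 0) x‖ₑ ^ 2 := lintegral_mono fun x => by
          rw [← ofReal_norm, norm_iteratedFDeriv_one, ofReal_norm]
          exact ofReal_frobeniusNormSq_le_three_mul_enorm_sq _
      _ = 3 * ∫⁻ x, ‖iteratedFDeriv ℝ 1 (u 0) x‖ₑ ^ 2 := lintegral_const_mul' _ _ (by norm_num)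
      _ ≤ 3 * C₁ := by gcongr; exact hC₁ 0 h0
      _ < ⊤ := ENNReal.mul_lt_top (by norm_num) ENNReal.coe_lt_top
  have hΦT : Φ T < ⊤ := by
    refine ENNReal.mul_lt_top ENNReal.ofReal_lt_top (ENNReal.add_lt_top.2 ⟨hE0, ?_⟩)
    refine ENNReal.mul_lt_top ?_ (ENNReal.mul_lt_top ENNReal.coe_lt_top ENNReal.ofReal_lt_top)
    exact ENNReal.inv_lt_top.2 (ENNReal.ofReal_pos.2 hν)
  refine ⟨(Φ T).toNNReal, fun t ht => ?_⟩
  rw [ENNReal.coe_toNNReal hΦT.ne]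
  refine (hmain t ht).trans ?_
  simp only [hΦdef]
  gcongr ENNReal.ofReal (Real.exp ?_) * (_ + _ * (_ * ENNReal.ofReal ?_))
  · exact mul_le_mul_of_nonneg_left (mul_le_mul_of_nonneg_left ht.2.le (sq_nonneg _)) hκ0
  · exact ht.2.le

end ForcedEnstrophyOfSupNorm

end Literature.Analysis.FluidPDE

end
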